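import Mathlib.MeasureTheory.Integral.DivergenceTheorem
import Mathlib.MeasureTheory.Measure.Haar.InnerProductSpace
import Mathlib.Analysis.ODE.Gronwall
import Literature.Analysis.FluidPDE.EnergyToolkit
import HarnessLib

/-!
# Energy uniqueness for classical no-slip Navier–Stokes solutions on a box

Tools for claims/route files that type «solutions on a bounded box with no-slip data» classically
(smooth slices on the whole space, equations pointwise in the OPEN box
`{x | ∀ j, aⱼ < xⱼ < bⱼ} ⊂ ℝ^{n+1}`, velocity vanishing on its boundary):

* the divergence theorem on the box for `C¹` fields vanishing on the faces
  (`EuclideanSpace.setIntegral_sum_fderiv_apply_eq_zero`, from Mathlib's box divergence theorem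
  transported along `PiLp.volume_preserving_toLp`), and the three integration-by-parts identities
  it yields with no-slip data: the pressure drops out (`setIntegral_inner_gradient_eq_zero_of_box`),
  convection is energy-neutral (`setIntegral_inner_convect_self_eq_zero_of_box`), Green's first
  identity (`setIntegral_inner_laplacian_self_of_box`);
* the energy inequality for the difference of two classical solutions at one time
  (`setIntegral_inner_timeDerivWithin_sub_le_of_box`), its time-integrated form over a compact set
  (`IsSmoothSpaceTimeOn.integral_Ioo_setIntegral_inner_timeDerivWithin_Ici`), and
* **uniqueness** (`EuclideanSpace.eqOn_openBox_of_noSlip_classical`): two velocity fields jointly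
  `C^∞` on `[0, ∞) × ℝ^{n+1}` solving the unforced system with `ν ≥ 0` in the open box, divergence
  free there, zero on the boundary and equal at `t = 0` on the open box, agree on the open box for
  all `t ≥ 0` (Grönwall via the tree's `le_mul_exp_of_le_add_mul_integral`).

All statements are theorems (no new definitions, no named facts).

## References
* L. C. Evans, *Partial Differential Equations*, 2nd ed., AMS 2010, App. C.2 (Thm 1–3).
* J. C. Robinson, J. L. Rodrigo, W. Sadowski, *The Three-Dimensional Navier–Stokes Equations*,
  CUP 2016, §6.3 (Thm 6.10, Exercise 6.5: uniqueness of strong solutions by the energy method).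
* R. Temam, *Navier–Stokes Equations*, North-Holland 1977, Ch. II Lemma 1.3 (`b(u, v, v) = 0`).
-/

noncomputable section

open MeasureTheory TopologicalSpace Set Function Filter InnerProductSpace
open scoped RealInnerProductSpace ENNReal NNReal Laplacian Topology ContDiff

namespace Literature.Analysis.FluidPDE

variable {n : ℕ}

/-! ### The box and its faces -/

/-- The open box is the preimage of a `Set.pi` of open intervals under `WithLp.ofLp`. [folklore] -/
private theorem EuclideanSpace.openBox_eq_preimage (a b : Fin (n+1) → ℝ) :
    {x : EuclideanSpace ℝ (Fin (n+1)) | ∀ j, a j < x j ∧ x j < b j} =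
      (WithLp.ofLp : EuclideanSpace ℝ (Fin (n+1)) → (Fin (n+1) → ℝ)) ⁻¹'
        (Set.pi univ fun j => Ioo (a j) (b j)) := by
  ext x; simp

/-- The closed box is the preimage of `Set.Icc a b` under `WithLp.ofLp`. [folklore] -/
private theorem EuclideanSpace.closedBox_eq_preimage (a b : Fin (n+1) → ℝ) :
    {x : EuclideanSpace ℝ (Fin (n+1)) | ∀ j, a j ≤ x j ∧ x j ≤ b j} =
      (WithLp.ofLp : EuclideanSpace ℝ (Fin (n+1)) → (Fin (n+1) → ℝ)) ⁻¹' Icc a b := by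
  ext x
  simp only [mem_setOf_eq, mem_preimage, mem_Icc, Pi.le_def]
  exact ⟨fun h => ⟨fun j => (h j).1, fun j => (h j).2⟩, fun h j => ⟨h.1 j, h.2 j⟩⟩

/-- Closure of the open box is the closed box (nondegenerate box). [folklore] -/
private theorem EuclideanSpace.closure_openBox (a b : Fin (n+1) → ℝ) (hab : ∀ i, a i < b i) :
    closure {x : EuclideanSpace ℝ (Fin (n+1)) | ∀ j, a j < x j ∧ x j < b j} =
      {x : EuclideanSpace ℝ (Fin (n+1)) | ∀ j, a j ≤ x j ∧ x j ≤ b j} := by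
  rw [EuclideanSpace.openBox_eq_preimage, EuclideanSpace.closedBox_eq_preimage]
  have hhome : (WithLp.ofLp : EuclideanSpace ℝ (Fin (n+1)) → (Fin (n+1) → ℝ)) =
      ⇑(PiLp.homeomorph 2 (fun _ : Fin (n+1) => ℝ)) := rfl
  rw [hhome, ← Homeomorph.preimage_closure, closure_pi_set, ← Set.pi_univ_Icc]
  congr 1
  ext y
  simp only [Set.mem_pi, Set.mem_univ, forall_const, closure_Ioo (hab _).ne]

/-- The open box is open. [folklore] -/
private theorem EuclideanSpace.isOpen_openBox (a b : Fin (n+1) → ℝ) :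
    IsOpen {x : EuclideanSpace ℝ (Fin (n+1)) | ∀ j, a j < x j ∧ x j < b j} := by
  rw [EuclideanSpace.openBox_eq_preimage]
  exact (isOpen_set_pi finite_univ fun j _ => isOpen_Ioo).preimage (PiLp.continuous_ofLp 2 _)

/-- A point of the closed box with one coordinate on a face lies on the frontier of the open box.
[folklore] -/
private theorem EuclideanSpace.mem_frontier_openBox (a b : Fin (n+1) → ℝ) (hab : ∀ i, a i < b i)
    {x : EuclideanSpace ℝ (Fin (n+1))} (hx : ∀ j, a j ≤ x j ∧ x j ≤ b j) {i : Fin (n+1)}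
    (hi : x i = a i ∨ x i = b i) :
    x ∈ frontier {x : EuclideanSpace ℝ (Fin (n+1)) | ∀ j, a j < x j ∧ x j < b j} := by
  rw [frontier, EuclideanSpace.closure_openBox a b hab, (EuclideanSpace.isOpen_openBox a b).interior_eq]
  refine ⟨hx, fun h => ?_⟩
  rcases hi with hi | hi
  · exact (h i).1.ne' hi
  · exact (h i).2.ne hi

/-- The open and the closed box agree almost everywhere. [folklore] -/
private theorem EuclideanSpace.openBox_ae_eq_closedBox (a b : Fin (n+1) → ℝ) :
    {x : EuclideanSpace ℝ (Fin (n+1)) | ∀ j, a j < x j ∧ x j < b j} =ᵐ[volume]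
      {x : EuclideanSpace ℝ (Fin (n+1)) | ∀ j, a j ≤ x j ∧ x j ≤ b j} := by
  rw [EuclideanSpace.openBox_eq_preimage, EuclideanSpace.closedBox_eq_preimage]
  have hmp := PiLp.volume_preserving_ofLp (Fin (n+1))
  exact hmp.quasiMeasurePreserving.preimage_ae_eq (Measure.univ_pi_Ioo_ae_eq_Icc)

end Literature.Analysis.FluidPDE

namespace Literature.Analysis.FluidPDE

variable {n : ℕ}

/-! ### The divergence theorem on a box for fields vanishing on the faces -/

/-- **Divergence theorem on a box of `ℝⁿ⁺¹` with vanishing face data.** For `C¹` scalar functions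
`Φᵢ` on `EuclideanSpace ℝ (Fin (n+1))` such that `Φᵢ` vanishes at the points of the closed box
`[a, b]` lying on the two faces `xᵢ = aᵢ`, `xᵢ = bᵢ`, the integral of `Σᵢ ∂ᵢΦᵢ` over the box is
zero (Mathlib's `integral_divergence_of_hasFDerivAt_off_countable'` transported along the
measure-preserving `WithLp.toLp : (Fin (n+1) → ℝ) → EuclideanSpace ℝ (Fin (n+1))`; Evans, *PDE*,
App. C.2 Thm. 1 with zero boundary data). [cite: Evans2010, App. C.2 Thm 1 (Gauss–Green)] -/
theorem EuclideanSpace.setIntegral_sum_fderiv_apply_eq_zero (a b : Fin (n+1) → ℝ) (hab : a ≤ b)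
    (Φ : Fin (n+1) → EuclideanSpace ℝ (Fin (n+1)) → ℝ) (hΦ : ∀ i, ContDiff ℝ 1 (Φ i))
    (h0 : ∀ i (x : EuclideanSpace ℝ (Fin (n+1))), (∀ j, a j ≤ x j ∧ x j ≤ b j) →
      (x i = a i ∨ x i = b i) → Φ i x = 0) :
    ∫ x in {x : EuclideanSpace ℝ (Fin (n+1)) | ∀ j, a j ≤ x j ∧ x j ≤ b j},
      ∑ i, fderiv ℝ (Φ i) x (EuclideanSpace.basisFun (Fin (n+1)) ℝ i) = 0 := by
  simp only [EuclideanSpace.basisFun_apply]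
  set L : (Fin (n+1) → ℝ) →L[ℝ] EuclideanSpace ℝ (Fin (n+1)) :=
    (EuclideanSpace.equiv (Fin (n+1)) ℝ).symm.toContinuousLinearMap with hLdef
  have hpre : (fun y : Fin (n+1) → ℝ => (WithLp.toLp 2 y : EuclideanSpace ℝ (Fin (n+1)))) ⁻¹'
      {x : EuclideanSpace ℝ (Fin (n+1)) | ∀ j, a j ≤ x j ∧ x j ≤ b j} = Icc a b := by
    ext y
    simp only [mem_preimage, mem_setOf_eq, mem_Icc, Pi.le_def]
    exact ⟨fun h => ⟨fun j => (h j).1, fun j => (h j).2⟩, fun h j => ⟨h.1 j, h.2 j⟩⟩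
  have hmp := PiLp.volume_preserving_toLp (Fin (n+1))
  have hemb : MeasurableEmbedding
      (WithLp.toLp 2 : (Fin (n+1) → ℝ) → EuclideanSpace ℝ (Fin (n+1))) :=
    (MeasurableEquiv.toLp 2 (Fin (n+1) → ℝ)).measurableEmbedding
  rw [← hmp.setIntegral_preimage_emb hemb, hpre]
  set f : Fin (n+1) → (Fin (n+1) → ℝ) → ℝ := fun i y => Φ i (WithLp.toLp 2 y) with hfdef
  set f' : Fin (n+1) → (Fin (n+1) → ℝ) → (Fin (n+1) → ℝ) →L[ℝ] ℝ :=
    fun i y => (fderiv ℝ (Φ i) (WithLp.toLp 2 y)).comp L with hf'def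
  have Hc : ∀ i, ContinuousOn (f i) (Icc a b) := fun i =>
    ((hΦ i).continuous.comp L.continuous).continuousOn
  have Hd : ∀ y ∈ (univ.pi fun i => Ioo (a i) (b i)) \ (∅ : Set (Fin (n+1) → ℝ)), ∀ i,
      HasFDerivAt (f i) (f' i y) y := by
    intro y _ i
    have h1 : HasFDerivAt (Φ i) (fderiv ℝ (Φ i) (L y)) (L y) :=
      ((hΦ i).differentiable one_ne_zero _).hasFDerivAt
    exact h1.comp y L.hasFDerivAt
  have hsum : ∀ y : Fin (n+1) → ℝ, ∑ i, f' i y (Pi.single i 1) =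
      ∑ i, fderiv ℝ (Φ i) (WithLp.toLp 2 y) (EuclideanSpace.single i 1) := by
    intro y; rfl
  have Hi : IntegrableOn (fun y => ∑ i, f' i y (Pi.single i 1)) (Icc a b) := by
    refine ContinuousOn.integrableOn_compact isCompact_Icc ?_
    refine (continuous_finsetSum _ (fun i _ => ?_)).continuousOn
    exact (((hΦ i).continuous_fderiv one_ne_zero).comp L.continuous).clm_apply continuous_const
  have key := integral_divergence_of_hasFDerivAt_off_countable' a b hab f f' ∅ countable_empty Hc Hd Hi
  rw [show (fun y : Fin (n+1) → ℝ => ∑ i, fderiv ℝ (Φ i) (WithLp.toLp 2 y) (EuclideanSpace.single i 1))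
      = fun y => ∑ i, f' i y (Pi.single i 1) from funext fun y => (hsum y).symm, key]
  refine Finset.sum_eq_zero fun i _ => ?_
  have hface : ∀ c : ℝ, (c = a i ∨ c = b i) → a i ≤ c → c ≤ b i →
      ∫ z in Icc (a ∘ i.succAbove) (b ∘ i.succAbove), f i (i.insertNth c z) = 0 := by
    intro c hc hac hcb
    refine setIntegral_eq_zero_of_forall_eq_zero fun z hz => ?_
    apply h0 i
    · intro j
      by_cases hj : j = i
      · subst hj
        simp only [Fin.insertNth_apply_same]
        exact ⟨hac, hcb⟩
      · obtain ⟨k, rfl⟩ := Fin.exists_succAbove_eq hj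
        simp only [Fin.insertNth_apply_succAbove]
        exact ⟨hz.1 k, hz.2 k⟩
    · simpa only [PiLp.toLp_apply, Fin.insertNth_apply_same] using hc
  rw [hface (b i) (Or.inr rfl) (hab i) le_rfl, hface (a i) (Or.inl rfl) le_rfl (hab i), sub_self]

/-! ### Three integration-by-parts identities on a box with no-slip data -/

section BoxIBP

/-- `Σᵢ ⟪v, bᵢ⟫ • L bᵢ = L v` for the standard orthonormal basis `b` and a continuous linear
map `L` (expansion of `v` in the basis). [folklore] -/
private theorem sum_inner_basisFun_smul_apply {F : Type*} [NormedAddCommGroup F] [NormedSpace ℝ F]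
    (L : EuclideanSpace ℝ (Fin (n+1)) →L[ℝ] F) (v : EuclideanSpace ℝ (Fin (n+1))) :
    ∑ i, ⟪v, EuclideanSpace.basisFun (Fin (n+1)) ℝ i⟫ • L (EuclideanSpace.basisFun (Fin (n+1)) ℝ i)
      = L v := by
  set b := EuclideanSpace.basisFun (Fin (n+1)) ℝ
  calc ∑ i, ⟪v, b i⟫ • L (b i) = ∑ i, L (⟪b i, v⟫ • b i) := by
        simp only [map_smul, real_inner_comm]
    _ = L (∑ i, ⟪b i, v⟫ • b i) := by rw [map_sum]
    _ = L v := by rw [b.sum_repr']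

/-- The closed box is compact. [folklore] -/
private theorem EuclideanSpace.isCompact_closedBox (a b : Fin (n+1) → ℝ) :
    IsCompact {x : EuclideanSpace ℝ (Fin (n+1)) | ∀ j, a j ≤ x j ∧ x j ≤ b j} := by
  rw [EuclideanSpace.closedBox_eq_preimage]
  have hhome : (WithLp.ofLp : EuclideanSpace ℝ (Fin (n+1)) → (Fin (n+1) → ℝ)) =
      ⇑(PiLp.homeomorph 2 (fun _ : Fin (n+1) => ℝ)) := rfl
  rw [hhome, Homeomorph.isCompact_preimage]
  exact isCompact_Icc

/-- The closed box is measurable. [folklore] -/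
private theorem EuclideanSpace.measurableSet_closedBox (a b : Fin (n+1) → ℝ) :
    MeasurableSet {x : EuclideanSpace ℝ (Fin (n+1)) | ∀ j, a j ≤ x j ∧ x j ≤ b j} :=
  (EuclideanSpace.isCompact_closedBox a b).isClosed.measurableSet

/-- No-slip data vanish at the face points of the closed box. [folklore] -/
private theorem eq_zero_of_face {F : Type*} (a b : Fin (n+1) → ℝ) (hab : ∀ i, a i < b i)
    {w : EuclideanSpace ℝ (Fin (n+1)) → F} {c : F}
    (hw0 : ∀ x ∈ frontier {x : EuclideanSpace ℝ (Fin (n+1)) | ∀ j, a j < x j ∧ x j < b j}, w x = c)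
    (i : Fin (n+1)) (x : EuclideanSpace ℝ (Fin (n+1))) (hx : ∀ j, a j ≤ x j ∧ x j ≤ b j)
    (hi : x i = a i ∨ x i = b i) : w x = c :=
  hw0 x (EuclideanSpace.mem_frontier_openBox a b hab hx hi)

/-- An integrand vanishing on the open box has zero integral over the closed box. [folklore] -/
private theorem setIntegral_closedBox_eq_zero_of_openBox (a b : Fin (n+1) → ℝ)
    {g : EuclideanSpace ℝ (Fin (n+1)) → ℝ}
    (hg : ∀ x ∈ {x : EuclideanSpace ℝ (Fin (n+1)) | ∀ j, a j < x j ∧ x j < b j}, g x = 0) :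
    ∫ x in {x : EuclideanSpace ℝ (Fin (n+1)) | ∀ j, a j ≤ x j ∧ x j ≤ b j}, g x = 0 := by
  rw [← setIntegral_congr_set (EuclideanSpace.openBox_ae_eq_closedBox a b)]
  exact setIntegral_eq_zero_of_forall_eq_zero hg

variable (a b : Fin (n+1) → ℝ)

/-- **The pressure drops out on a box with no-slip data**: for `q ∈ C¹` and `w ∈ C¹` with
`div w = 0` in the open box and `w = 0` on its boundary, `∫_box ⟪∇q, w⟫ = 0` (divergence theorem
applied to `q w`; Temam 1977, Ch. I (1.12)/(2.10)). [cite: Evans2010, App. C.2 Thm 2 (integration by parts, zero boundary term)] -/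
theorem EuclideanSpace.setIntegral_inner_gradient_eq_zero_of_box (hab : ∀ i, a i < b i)
    {q : EuclideanSpace ℝ (Fin (n+1)) → ℝ} {w : EuclideanSpace ℝ (Fin (n+1)) → EuclideanSpace ℝ (Fin (n+1))}
    (hq : ContDiff ℝ 1 q) (hw : ContDiff ℝ 1 w)
    (hdiv : ∀ x ∈ {x : EuclideanSpace ℝ (Fin (n+1)) | ∀ j, a j < x j ∧ x j < b j},
      VectorCalculus.divergence w x = 0)
    (hw0 : ∀ x ∈ frontier {x : EuclideanSpace ℝ (Fin (n+1)) | ∀ j, a j < x j ∧ x j < b j}, w x = 0) :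
    ∫ x in {x : EuclideanSpace ℝ (Fin (n+1)) | ∀ j, a j ≤ x j ∧ x j ≤ b j}, ⟪gradient q x, w x⟫ = 0 := by
  set bF := EuclideanSpace.basisFun (Fin (n+1)) ℝ with hbF
  set Φ : Fin (n+1) → EuclideanSpace ℝ (Fin (n+1)) → ℝ := fun i x => q x * ⟪w x, bF i⟫ with hΦ
  have hΦc : ∀ i, ContDiff ℝ 1 (Φ i) := fun i => hq.mul (hw.inner ℝ contDiff_const)
  have h0 : ∀ i (x : EuclideanSpace ℝ (Fin (n+1))), (∀ j, a j ≤ x j ∧ x j ≤ b j) →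
      (x i = a i ∨ x i = b i) → Φ i x = 0 := by
    intro i x hx hi
    simp [hΦ, eq_zero_of_face a b hab hw0 i x hx hi]
  have key := EuclideanSpace.setIntegral_sum_fderiv_apply_eq_zero a b
    (fun i => (hab i).le) Φ hΦc h0
  -- pointwise: `Σᵢ ∂ᵢΦᵢ = ⟪∇q, w⟫ + q div w`
  have hpt : ∀ x, ∑ i, fderiv ℝ (Φ i) x (bF i) =
      ⟪gradient q x, w x⟫ + q x * VectorCalculus.divergence w x := by
    intro x
    have hqd : DifferentiableAt ℝ q x := hq.differentiable one_ne_zero x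
    have hwd : DifferentiableAt ℝ w x := hw.differentiable one_ne_zero x
    have hterm : ∀ i, fderiv ℝ (Φ i) x (bF i) =
        ⟪w x, bF i⟫ * fderiv ℝ q x (bF i) + q x * ⟪fderiv ℝ w x (bF i), bF i⟫ := by
      intro i
      have hwi : DifferentiableAt ℝ (fun y => ⟪w y, bF i⟫) x :=
        hwd.inner ℝ (differentiableAt_const _)
      rw [show Φ i = fun y => q y * ⟪w y, bF i⟫ from rfl, fderiv_fun_mul hqd hwi]
      simp only [add_apply, FunLike.coe_smul, Pi.smul_apply,
        smul_eq_mul, fderiv_inner_apply ℝ hwd (differentiableAt_const _), fderiv_fun_const,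
        Pi.zero_apply, zero_apply, inner_zero_right, zero_add]
      ring
    simp_rw [hterm, Finset.sum_add_distrib, ← Finset.mul_sum]
    congr 1
    · have h1 := sum_inner_basisFun_smul_apply (fderiv ℝ q x) (w x)
      simp only [smul_eq_mul] at h1
      rw [h1, gradient, InnerProductSpace.toDual_symm_apply]
    · rw [divergence_eq_sum_inner_fderiv bF]
      exact congrArg _ (Finset.sum_congr rfl fun i _ => real_inner_comm _ _)
  rw [← hbF] at key
  simp_rw [hpt] at key
  have hK := EuclideanSpace.isCompact_closedBox a b
  have hi1 : IntegrableOn (fun x => ⟪gradient q x, w x⟫)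
      {x : EuclideanSpace ℝ (Fin (n+1)) | ∀ j, a j ≤ x j ∧ x j ≤ b j} :=
    ((continuous_gradient_of_contDiff hq).inner hw.continuous).continuousOn.integrableOn_compact hK
  have hi2 : IntegrableOn (fun x => q x * VectorCalculus.divergence w x)
      {x : EuclideanSpace ℝ (Fin (n+1)) | ∀ j, a j ≤ x j ∧ x j ≤ b j} :=
    (hq.continuous.mul (continuous_divergence (hw.continuous_fderiv one_ne_zero))).continuousOn
      |>.integrableOn_compact hK
  rw [integral_add hi1 hi2, setIntegral_closedBox_eq_zero_of_openBox a b
    (g := fun x => q x * VectorCalculus.divergence w x)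
    (fun x hx => by rw [hdiv x hx, mul_zero]), add_zero] at key
  exact key

/-- **Convection is energy-neutral on a box with no-slip data**: for `v ∈ C¹` with `div v = 0` in
the open box and `w ∈ C¹` with `w = 0` on its boundary, `∫_box ⟪(v·∇)w, w⟫ = 0` (divergence
theorem applied to `½|w|² v`; Temam 1977, Ch. II Lemma 1.3 `b(u,v,v) = 0`). [cite: Evans2010, App. C.2 Thm 2 (integration by parts, zero boundary term)] -/
theorem EuclideanSpace.setIntegral_inner_convect_self_eq_zero_of_box (hab : ∀ i, a i < b i)
    {v w : EuclideanSpace ℝ (Fin (n+1)) → EuclideanSpace ℝ (Fin (n+1))}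
    (hv : ContDiff ℝ 1 v) (hw : ContDiff ℝ 1 w)
    (hdiv : ∀ x ∈ {x : EuclideanSpace ℝ (Fin (n+1)) | ∀ j, a j < x j ∧ x j < b j},
      VectorCalculus.divergence v x = 0)
    (hw0 : ∀ x ∈ frontier {x : EuclideanSpace ℝ (Fin (n+1)) | ∀ j, a j < x j ∧ x j < b j}, w x = 0) :
    ∫ x in {x : EuclideanSpace ℝ (Fin (n+1)) | ∀ j, a j ≤ x j ∧ x j ≤ b j}, ⟪convect v w x, w x⟫ = 0 := by
  set bF := EuclideanSpace.basisFun (Fin (n+1)) ℝ with hbF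
  set Φ : Fin (n+1) → EuclideanSpace ℝ (Fin (n+1)) → ℝ :=
    fun i x => (2⁻¹ * ⟪w x, w x⟫) * ⟪v x, bF i⟫ with hΦ
  have hΦc : ∀ i, ContDiff ℝ 1 (Φ i) := fun i =>
    (contDiff_const.mul (hw.inner ℝ hw)).mul (hv.inner ℝ contDiff_const)
  have h0 : ∀ i (x : EuclideanSpace ℝ (Fin (n+1))), (∀ j, a j ≤ x j ∧ x j ≤ b j) →
      (x i = a i ∨ x i = b i) → Φ i x = 0 := by
    intro i x hx hi
    simp [hΦ, eq_zero_of_face a b hab hw0 i x hx hi]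
  have key := EuclideanSpace.setIntegral_sum_fderiv_apply_eq_zero a b
    (fun i => (hab i).le) Φ hΦc h0
  have hpt : ∀ x, ∑ i, fderiv ℝ (Φ i) x (bF i) =
      ⟪convect v w x, w x⟫ + 2⁻¹ * ⟪w x, w x⟫ * VectorCalculus.divergence v x := by
    intro x
    have hvd : DifferentiableAt ℝ v x := hv.differentiable one_ne_zero x
    have hwd : DifferentiableAt ℝ w x := hw.differentiable one_ne_zero x
    have hθd : DifferentiableAt ℝ (fun y => 2⁻¹ * ⟪w y, w y⟫) x := (hwd.inner ℝ hwd).const_mul _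
    have hterm : ∀ i, fderiv ℝ (Φ i) x (bF i) =
        ⟪v x, bF i⟫ * ⟪fderiv ℝ w x (bF i), w x⟫ +
          2⁻¹ * ⟪w x, w x⟫ * ⟪fderiv ℝ v x (bF i), bF i⟫ := by
      intro i
      have hvi : DifferentiableAt ℝ (fun y => ⟪v y, bF i⟫) x :=
        hvd.inner ℝ (differentiableAt_const _)
      rw [show Φ i = fun y => (2⁻¹ * ⟪w y, w y⟫) * ⟪v y, bF i⟫ from rfl, fderiv_fun_mul hθd hvi,
        fderiv_const_mul (hwd.inner ℝ hwd)]
      simp only [add_apply, FunLike.coe_smul, Pi.smul_apply,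
        smul_eq_mul, fderiv_inner_apply ℝ hvd (differentiableAt_const _),
        fderiv_inner_apply ℝ hwd hwd, fderiv_fun_const,
        Pi.zero_apply, zero_apply, inner_zero_right, zero_add]
      rw [real_inner_comm (w x) (fderiv ℝ w x (bF i))]
      ring
    simp_rw [hterm, Finset.sum_add_distrib, ← Finset.mul_sum]
    congr 1
    · have h1 := sum_inner_basisFun_smul_apply (fderiv ℝ w x) (v x)
      rw [convect, ← h1, sum_inner]
      simp only [real_inner_smul_left, hbF]
    · rw [divergence_eq_sum_inner_fderiv bF]
      exact congrArg _ (Finset.sum_congr rfl fun i _ => real_inner_comm _ _)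
  rw [← hbF] at key
  simp_rw [hpt] at key
  have hK := EuclideanSpace.isCompact_closedBox a b
  have hi1 : IntegrableOn (fun x => ⟪convect v w x, w x⟫)
      {x : EuclideanSpace ℝ (Fin (n+1)) | ∀ j, a j ≤ x j ∧ x j ≤ b j} :=
    (((hw.continuous_fderiv one_ne_zero).clm_apply hv.continuous).inner hw.continuous).continuousOn
      |>.integrableOn_compact hK
  have hi2 : IntegrableOn (fun x => 2⁻¹ * ⟪w x, w x⟫ * VectorCalculus.divergence v x)
      {x : EuclideanSpace ℝ (Fin (n+1)) | ∀ j, a j ≤ x j ∧ x j ≤ b j} :=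
    ((continuous_const.mul (hw.continuous.inner hw.continuous)).mul
      (continuous_divergence (hv.continuous_fderiv one_ne_zero))).continuousOn.integrableOn_compact hK
  rw [integral_add hi1 hi2, setIntegral_closedBox_eq_zero_of_openBox a b
    (g := fun x => 2⁻¹ * ⟪w x, w x⟫ * VectorCalculus.divergence v x)
    (fun x hx => by rw [hdiv x hx, mul_zero]), add_zero] at key
  exact key

/-- **Green's first identity on a box with no-slip data**: for `w ∈ C²` with `w = 0` on the
boundary of the box, `∫_box ⟪Δw, w⟫ = −∫_box |∇w|²` (divergence theorem applied to
`Σⱼ wⱼ∇wⱼ`; Evans, *PDE*, App. C.2 Thm. 3 with zero boundary data). [cite: Evans2010, App. C.2 Thm 3 (Green's formulas, zero boundary term)] -/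
theorem EuclideanSpace.setIntegral_inner_laplacian_self_of_box (hab : ∀ i, a i < b i)
    {w : EuclideanSpace ℝ (Fin (n+1)) → EuclideanSpace ℝ (Fin (n+1))} (hw : ContDiff ℝ 2 w)
    (hw0 : ∀ x ∈ frontier {x : EuclideanSpace ℝ (Fin (n+1)) | ∀ j, a j < x j ∧ x j < b j}, w x = 0) :
    ∫ x in {x : EuclideanSpace ℝ (Fin (n+1)) | ∀ j, a j ≤ x j ∧ x j ≤ b j}, ⟪(Δ w) x, w x⟫ =
      - ∫ x in {x : EuclideanSpace ℝ (Fin (n+1)) | ∀ j, a j ≤ x j ∧ x j ≤ b j},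
          frobeniusNormSq (fderiv ℝ w x) := by
  set bF := EuclideanSpace.basisFun (Fin (n+1)) ℝ with hbF
  have hw1 : ContDiff ℝ 1 w := hw.of_le one_le_two
  have hdw : ∀ i, ContDiff ℝ 1 fun y => fderiv ℝ w y (bF i) := fun i =>
    (hw.fderiv_right (m := 1) le_rfl).clm_apply contDiff_const
  set Φ : Fin (n+1) → EuclideanSpace ℝ (Fin (n+1)) → ℝ :=
    fun i x => ⟪fderiv ℝ w x (bF i), w x⟫ with hΦ
  have hΦc : ∀ i, ContDiff ℝ 1 (Φ i) := fun i => (hdw i).inner ℝ hw1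
  have h0 : ∀ i (x : EuclideanSpace ℝ (Fin (n+1))), (∀ j, a j ≤ x j ∧ x j ≤ b j) →
      (x i = a i ∨ x i = b i) → Φ i x = 0 := by
    intro i x hx hi
    simp [hΦ, eq_zero_of_face a b hab hw0 i x hx hi]
  have key := EuclideanSpace.setIntegral_sum_fderiv_apply_eq_zero a b
    (fun i => (hab i).le) Φ hΦc h0
  have hpt : ∀ x, ∑ i, fderiv ℝ (Φ i) x (bF i) =
      ⟪(Δ w) x, w x⟫ + frobeniusNormSq (fderiv ℝ w x) := by
    intro x
    have hwd : DifferentiableAt ℝ w x := hw1.differentiable one_ne_zero x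
    have hterm : ∀ i, fderiv ℝ (Φ i) x (bF i) =
        ⟪fderiv ℝ (fun y => fderiv ℝ w y (bF i)) x (bF i), w x⟫ +
          ⟪fderiv ℝ w x (bF i), fderiv ℝ w x (bF i)⟫ := by
      intro i
      have hdi : DifferentiableAt ℝ (fun y => fderiv ℝ w y (bF i)) x :=
        (hdw i).differentiable one_ne_zero x
      rw [show Φ i = fun y => ⟪fderiv ℝ w y (bF i), w y⟫ from rfl, fderiv_inner_apply ℝ hdi hwd]
      ring
    simp_rw [hterm, Finset.sum_add_distrib]
    congr 1
    · rw [laplacian_eq_sum_fderiv_fderiv bF hw x, sum_inner]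
    · rw [frobeniusNormSq_eq_sum bF]
      exact Finset.sum_congr rfl fun i _ => real_inner_self_eq_norm_sq _
  rw [← hbF] at key
  simp_rw [hpt] at key
  have hK := EuclideanSpace.isCompact_closedBox a b
  have hi1 : IntegrableOn (fun x => ⟪(Δ w) x, w x⟫)
      {x : EuclideanSpace ℝ (Fin (n+1)) | ∀ j, a j ≤ x j ∧ x j ≤ b j} :=
    ((continuous_laplacian hw).inner hw.continuous).continuousOn.integrableOn_compact hK
  have hi2 : IntegrableOn (fun x => frobeniusNormSq (fderiv ℝ w x))
      {x : EuclideanSpace ℝ (Fin (n+1)) | ∀ j, a j ≤ x j ∧ x j ≤ b j} := by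
    refine ContinuousOn.integrableOn_compact hK (Continuous.continuousOn ?_)
    rw [show (fun x => frobeniusNormSq (fderiv ℝ w x)) =
        fun x => ∑ i, ‖fderiv ℝ w x (bF i)‖ ^ 2 from funext fun x => frobeniusNormSq_eq_sum bF _]
    exact continuous_finsetSum _ fun i _ =>
      (((hw.continuous_fderiv (by norm_num)).clm_apply continuous_const).norm).pow 2
  rw [integral_add hi1 hi2] at key
  linarith

end BoxIBP

end Literature.Analysis.FluidPDE

/-! ### Energy uniqueness for classical no-slip solutions on a box

The classical energy argument (Robinson–Rodrigo–Sadowski 2016 §6.3; Temam 1977 Ch. III: `w = u − u'`,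
`½ d/dt ‖w‖² + ν‖∇w‖² = −b(w, u, w)`, Grönwall with `w(0) = 0`), for solutions that are jointly
`C^∞` on `[0, ∞) × ℝ^{n+1}`, satisfy the equations pointwise in the OPEN box, vanish on its boundary,
and share the datum on the open box. Pressure slices only need to be `C¹`. -/

namespace Literature.Analysis.FluidPDE

variable {n : ℕ}

/-- **Continuity in time of space integrals over a compact set**: for `G` continuous on
`[0, T] × E` and `K` compact, `t ↦ ∫_K G(t, x) dx` is continuous on `[0, T]` (dominated convergence
with a constant majorant). [folklore] -/
private theorem EuclideanSpace.continuousOn_setIntegral_of_continuousOn_Icc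
    {K : Set (EuclideanSpace ℝ (Fin (n+1)))} (hK : IsCompact K)
    {G : ℝ × EuclideanSpace ℝ (Fin (n+1)) → ℝ} {T : ℝ} (hG : ContinuousOn G (Icc 0 T ×ˢ univ)) :
    ContinuousOn (fun t => ∫ x in K, G (t, x)) (Icc 0 T) := by
  obtain ⟨C, hC⟩ := (isCompact_Icc.prod hK).exists_bound_of_continuousOn
    (hG.mono (prod_mono Subset.rfl (subset_univ _)))
  refine continuousOn_of_dominated (bound := fun _ => C) ?_ ?_ ?_ ?_
  · intro t ht
    refine ContinuousOn.aestronglyMeasurable ?_ hK.measurableSet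
    exact hG.comp (continuous_const.prodMk continuous_id).continuousOn
      fun x _ => mk_mem_prod ht (mem_univ x)
  · intro t ht
    exact (ae_restrict_iff' hK.measurableSet).2
      (Eventually.of_forall fun x hx => hC (t, x) ⟨ht, hx⟩)
  · exact continuousOn_const.integrableOn_compact hK
  · exact Eventually.of_forall fun x =>
      hG.comp (continuous_id.prodMk continuous_const).continuousOn
        fun t ht => mk_mem_prod ht (mem_univ x)

/-- **A uniform gradient bound on `[0, T] × K`** for a field jointly smooth on `[0, ∞) × E` and `K`
compact (continuity of `(t, x) ↦ D(w t)(x)` on the compact slab). [folklore] -/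
private theorem IsSmoothSpaceTimeOn.exists_norm_fderiv_le_of_isCompact {F' : Type*} [NormedAddCommGroup F']
    [NormedSpace ℝ F'] {K : Set (EuclideanSpace ℝ (Fin (n+1)))} (hK : IsCompact K)
    {w : ℝ → EuclideanSpace ℝ (Fin (n+1)) → F'} (hw : IsSmoothSpaceTimeOn (Ici 0) w) (T : ℝ) :
    ∃ M : ℝ, 0 ≤ M ∧ ∀ τ ∈ Icc 0 T, ∀ x ∈ K, ‖fderiv ℝ (w τ) x‖ ≤ M := by
  have hc := (hw.fderiv_slice (uniqueDiffOn_Ici 0)).continuousOn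
  obtain ⟨C, hC⟩ := (isCompact_Icc.prod hK).exists_bound_of_continuousOn
    (hc.mono (prod_mono Icc_subset_Ici_self (subset_univ _)))
  exact ⟨max C 0, le_max_right _ _, fun τ hτ x hx => (hC (τ, x) ⟨hτ, hx⟩).trans (le_max_left _ _)⟩

/-- **Time integration of `∫_K ⟪∂ₜ w, w⟫` over a compact set** for a field jointly smooth on
`[0, ∞) × E` (one-sided time derivative within `[0, ∞)`), `0 ≤ t`:
`∫₀ᵗ ∫_K ⟪∂ₜ w, w⟫ dx dτ = ½ ∫_K ‖w(t)‖² − ½ ∫_K ‖w(0)‖²` (Fubini on `(0, t) × K` and the fundamental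
theorem of calculus on each time line; the pattern of the tree's
`IsSmoothSpaceTimeOn.integral_Ioo_integral_mul_inner_timeDerivWithin`). [folklore] -/
private theorem IsSmoothSpaceTimeOn.integral_Ioo_setIntegral_inner_timeDerivWithin_Ici {F' : Type*}
    [NormedAddCommGroup F'] [InnerProductSpace ℝ F'] {K : Set (EuclideanSpace ℝ (Fin (n+1)))}
    (hK : IsCompact K) {w : ℝ → EuclideanSpace ℝ (Fin (n+1)) → F'}
    (hw : IsSmoothSpaceTimeOn (Ici 0) w) {t : ℝ} (ht : 0 ≤ t) :
    ∫ τ in Ioo 0 t, ∫ x in K, ⟪FluidPDE.timeDerivWithin (Ici 0) w τ x, w τ x⟫ =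
      2⁻¹ * (∫ x in K, ‖w t x‖ ^ 2) - 2⁻¹ * (∫ x in K, ‖w 0 x‖ ^ 2) := by
  have hU : UniqueDiffOn ℝ (Ici (0 : ℝ)) := uniqueDiffOn_Ici 0
  have hu_cont : ContinuousOn (uncurry w) (Ici 0 ×ˢ univ) := hw.continuousOn
  have hdt_cont : ContinuousOn (uncurry (FluidPDE.timeDerivWithin (Ici 0) w)) (Ici 0 ×ˢ univ) :=
    (hw.timeDerivWithin hU).continuousOn
  set D : ℝ × EuclideanSpace ℝ (Fin (n+1)) → ℝ :=
    fun z => ⟪FluidPDE.timeDerivWithin (Ici 0) w z.1 z.2, w z.1 z.2⟫ with hD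
  have hDcont : ContinuousOn D (Ici 0 ×ˢ univ) := hdt_cont.inner hu_cont
  have hDint : Integrable (uncurry fun τ x => D (τ, x))
      ((volume.restrict (Ioo 0 t)).prod (volume.restrict K)) := by
    rw [Measure.prod_restrict]
    have hc : IntegrableOn D (Icc 0 t ×ˢ K) (volume.prod volume) :=
      (hDcont.mono (prod_mono Icc_subset_Ici_self (subset_univ _))).integrableOn_compact
        (isCompact_Icc.prod hK)
    exact hc.mono_set (prod_mono Ioo_subset_Icc_self Subset.rfl)
  have hswap := integral_integral_swap hDint
  simp only [hD] at hswap
  rw [hswap]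
  have hslice : ∀ {r : ℝ}, 0 ≤ r → Integrable (fun x => ‖w r x‖ ^ 2) (volume.restrict K) :=
    fun {r} hr => (((hw.contDiff_slice (show r ∈ Ici (0 : ℝ) from hr)).continuous.norm.pow
      2).continuousOn).integrableOn_compact hK
  have hline : ∀ x, ∫ τ in Ioo 0 t, ⟪FluidPDE.timeDerivWithin (Ici 0) w τ x, w τ x⟫ =
      2⁻¹ * ‖w t x‖ ^ 2 - 2⁻¹ * ‖w 0 x‖ ^ 2 := by
    intro x
    rcases eq_or_lt_of_le ht with h0 | ht'
    · rw [← h0]; simp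
    have hcont : ContinuousOn (fun τ => 2⁻¹ * ‖w τ x‖ ^ 2) (Icc 0 t) := by
      refine continuousOn_const.mul (ContinuousOn.pow ?_ 2)
      exact (hu_cont.comp (Continuous.prodMk_left x).continuousOn
        fun τ hτ => mk_mem_prod (Icc_subset_Ici_self hτ) (mem_univ x)).norm
    have hderiv : ∀ τ ∈ Ioo 0 t, HasDerivWithinAt (fun τ => 2⁻¹ * ‖w τ x‖ ^ 2)
        ⟪FluidPDE.timeDerivWithin (Ici 0) w τ x, w τ x⟫ (Ioi τ) τ := by
      intro τ hτ
      have hu' : HasDerivAt (fun σ => w σ x) (FluidPDE.timeDerivWithin (Ici 0) w τ x) τ :=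
        (hw.hasDerivWithinAt_timeDerivWithin hU (show τ ∈ Ici (0 : ℝ) from hτ.1.le) x).hasDerivAt
          (Ici_mem_nhds hτ.1)
      have h2 := ((hu'.inner ℝ hu').const_mul 2⁻¹).hasDerivWithinAt (s := Ioi τ)
      have hfun : (fun σ => 2⁻¹ * ⟪w σ x, w σ x⟫) = fun σ => 2⁻¹ * ‖w σ x‖ ^ 2 := by
        funext σ
        rw [real_inner_self_eq_norm_sq]
      rw [hfun] at h2
      refine h2.congr_deriv ?_
      rw [real_inner_comm]
      ring
    have hint : IntervalIntegrable
        (fun τ => ⟪FluidPDE.timeDerivWithin (Ici 0) w τ x, w τ x⟫) volume 0 t := by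
      refine ContinuousOn.intervalIntegrable ?_
      rw [uIcc_of_le ht]
      exact hDcont.comp (Continuous.prodMk_left x).continuousOn
        fun τ hτ => mk_mem_prod (Icc_subset_Ici_self hτ) (mem_univ x)
    have := intervalIntegral.integral_eq_sub_of_hasDeriv_right_of_le ht hcont hderiv hint
    rw [intervalIntegral.integral_of_le ht, integral_Ioc_eq_integral_Ioo] at this
    rw [this]
  rw [integral_congr_ae (Eventually.of_forall hline), integral_sub ((hslice ht).const_mul _)
    ((hslice le_rfl).const_mul _), integral_const_mul, integral_const_mul]

/-- Divergence of a difference (pointwise). [folklore] -/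
private theorem divergence_fun_sub_apply {u v : EuclideanSpace ℝ (Fin (n+1)) → EuclideanSpace ℝ (Fin (n+1))}
    {x : EuclideanSpace ℝ (Fin (n+1))} (hu : DifferentiableAt ℝ u x) (hv : DifferentiableAt ℝ v x) :
    VectorCalculus.divergence (fun y => u y - v y) x =
      VectorCalculus.divergence u x - VectorCalculus.divergence v x := by
  unfold VectorCalculus.divergence
  rw [fderiv_fun_sub hu hv, ContinuousLinearMap.toLinearMap_sub, map_sub]

/-- **The energy inequality at one time, on a box with no-slip data.** For two fields `u, u'`
jointly smooth on `[0, ∞) × E` which at time `τ ≥ 0` satisfy the Navier–Stokes momentum equation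
(one-sided time derivative within `[0, ∞)`, `C¹` pressures) pointwise in the open box, are
divergence free there and vanish on its boundary, the difference `w = u − u'` satisfies
`∫_box ⟪∂ₜw, w⟫ ≤ M ∫_box ‖w‖²` whenever `‖D(u τ)‖ ≤ M` on the closed box: the transport term
`∫⟪(u'·∇)w, w⟫`, both pressure terms vanish (no-slip), the viscous term is `−ν∫|∇w|² ≤ 0`, and
`|⟪(w·∇)u, w⟫| ≤ ‖Du‖ ‖w‖²` (the energy estimate for the difference of two solutions, Robinson–Rodrigo–Sadowski 2016 §6.3, proof of Thm 6.10 / Exercise 6.5, here for classical no-slip data on a box). [cite: RobinsonRodrigoSadowskiCUP2016, §6.3 Thm 6.10 proof / Exercise 6.5] -/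
theorem EuclideanSpace.setIntegral_inner_timeDerivWithin_sub_le_of_box (a b : Fin (n+1) → ℝ)
    (hab : ∀ i, a i < b i) {ν : ℝ} (hν : 0 ≤ ν)
    {u u' : ℝ → EuclideanSpace ℝ (Fin (n+1)) → EuclideanSpace ℝ (Fin (n+1))}
    {p p' : ℝ → EuclideanSpace ℝ (Fin (n+1)) → ℝ}
    (hu : IsSmoothSpaceTimeOn (Ici 0) u) (hu' : IsSmoothSpaceTimeOn (Ici 0) u') {τ : ℝ} (hτ : 0 ≤ τ)
    (hp : ContDiff ℝ 1 (p τ)) (hp' : ContDiff ℝ 1 (p' τ))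
    (hmom : ∀ x ∈ {x : EuclideanSpace ℝ (Fin (n+1)) | ∀ j, a j < x j ∧ x j < b j},
      FluidPDE.timeDerivWithin (Ici 0) u τ x + convect (u τ) (u τ) x =
        -gradient (p τ) x + ν • (Δ (u τ)) x)
    (hmom' : ∀ x ∈ {x : EuclideanSpace ℝ (Fin (n+1)) | ∀ j, a j < x j ∧ x j < b j},
      FluidPDE.timeDerivWithin (Ici 0) u' τ x + convect (u' τ) (u' τ) x =
        -gradient (p' τ) x + ν • (Δ (u' τ)) x)
    (hdiv : ∀ x ∈ {x : EuclideanSpace ℝ (Fin (n+1)) | ∀ j, a j < x j ∧ x j < b j},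
      VectorCalculus.divergence (u τ) x = 0)
    (hdiv' : ∀ x ∈ {x : EuclideanSpace ℝ (Fin (n+1)) | ∀ j, a j < x j ∧ x j < b j},
      VectorCalculus.divergence (u' τ) x = 0)
    (hbc : ∀ x ∈ frontier {x : EuclideanSpace ℝ (Fin (n+1)) | ∀ j, a j < x j ∧ x j < b j}, u τ x = 0)
    (hbc' : ∀ x ∈ frontier {x : EuclideanSpace ℝ (Fin (n+1)) | ∀ j, a j < x j ∧ x j < b j}, u' τ x = 0)
    {M : ℝ} (hM : ∀ x ∈ {x : EuclideanSpace ℝ (Fin (n+1)) | ∀ j, a j ≤ x j ∧ x j ≤ b j},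
      ‖fderiv ℝ (u τ) x‖ ≤ M) :
    ∫ x in {x : EuclideanSpace ℝ (Fin (n+1)) | ∀ j, a j ≤ x j ∧ x j ≤ b j},
        ⟪FluidPDE.timeDerivWithin (Ici 0) (fun s y => u s y - u' s y) τ x, u τ x - u' τ x⟫ ≤
      M * ∫ x in {x : EuclideanSpace ℝ (Fin (n+1)) | ∀ j, a j ≤ x j ∧ x j ≤ b j},
        ‖u τ x - u' τ x‖ ^ 2 := by
  set K := {x : EuclideanSpace ℝ (Fin (n+1)) | ∀ j, a j ≤ x j ∧ x j ≤ b j} with hK_def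
  set U := {x : EuclideanSpace ℝ (Fin (n+1)) | ∀ j, a j < x j ∧ x j < b j} with hU_def
  have hKc : IsCompact K := EuclideanSpace.isCompact_closedBox a b
  have hKm : MeasurableSet K := EuclideanSpace.measurableSet_closedBox a b
  have hUo : IsOpen U := EuclideanSpace.isOpen_openBox a b
  have hUK : U =ᵐ[volume] K := EuclideanSpace.openBox_ae_eq_closedBox a b
  have hS : UniqueDiffOn ℝ (Ici (0 : ℝ)) := uniqueDiffOn_Ici 0
  have hτ' : τ ∈ Ici (0 : ℝ) := hτ
  -- the difference field and its regularity
  set w : EuclideanSpace ℝ (Fin (n+1)) → EuclideanSpace ℝ (Fin (n+1)) := fun y => u τ y - u' τ y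
    with hw_def
  have hwst : IsSmoothSpaceTimeOn (Ici 0) (fun s y => u s y - u' s y) := hu.sub hu'
  have huC : ContDiff ℝ ∞ (u τ) := hu.contDiff_slice hτ'
  have hu'C : ContDiff ℝ ∞ (u' τ) := hu'.contDiff_slice hτ'
  have hwC : ContDiff ℝ ∞ w := huC.sub hu'C
  have hwC1 : ContDiff ℝ 1 w := hwC.of_le (by simp)
  have hwC2 : ContDiff ℝ 2 w := contDiff_infty.1 hwC 2
  have hu'C1 : ContDiff ℝ 1 (u' τ) := hu'C.of_le (by simp)
  have hud : ∀ x, DifferentiableAt ℝ (u τ) x := fun x =>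
    (huC.differentiable (by simp)) x
  have hu'd : ∀ x, DifferentiableAt ℝ (u' τ) x := fun x =>
    (hu'C.differentiable (by simp)) x
  have hw0 : ∀ x ∈ frontier U, w x = 0 := fun x hx => by
    simp [hw_def, hbc x hx, hbc' x hx]
  have hdivw : ∀ x ∈ U, VectorCalculus.divergence w x = 0 := fun x hx => by
    rw [hw_def, divergence_fun_sub_apply (hud x) (hu'd x), hdiv x hx, hdiv' x hx, sub_zero]
  -- the five integrands
  set f1 : EuclideanSpace ℝ (Fin (n+1)) → ℝ := fun x => ⟪convect w (u τ) x, w x⟫ with hf1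
  set f2 : EuclideanSpace ℝ (Fin (n+1)) → ℝ := fun x => ⟪(Δ w) x, w x⟫ with hf2
  set f3 : EuclideanSpace ℝ (Fin (n+1)) → ℝ := fun x => ⟪convect (u' τ) w x, w x⟫ with hf3
  set f4 : EuclideanSpace ℝ (Fin (n+1)) → ℝ := fun x => ⟪gradient (p τ) x, w x⟫ with hf4
  set f5 : EuclideanSpace ℝ (Fin (n+1)) → ℝ := fun x => ⟪gradient (p' τ) x, w x⟫ with hf5
  have hΔw : ContDiff ℝ ∞ fun x => (Δ w) x := (hwst.laplacian hS).contDiff_slice hτ'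
  have c1 : Continuous f1 :=
    ((huC.continuous_fderiv (by simp)).clm_apply hwC.continuous).inner
      hwC.continuous
  have c2 : Continuous f2 := hΔw.continuous.inner hwC.continuous
  have c3 : Continuous f3 :=
    ((hwC.continuous_fderiv (by simp)).clm_apply hu'C.continuous).inner
      hwC.continuous
  have hgc : ∀ {q : EuclideanSpace ℝ (Fin (n+1)) → ℝ}, ContDiff ℝ 1 q → Continuous (gradient q) :=
    fun {q} hq => by
      have : gradient q = fun x => (InnerProductSpace.toDual ℝ _).symm (fderiv ℝ q x) := rfl
      rw [this]
      exact (InnerProductSpace.toDual ℝ _).symm.continuous.comp (hq.continuous_fderiv (by simp))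
  have c4 : Continuous f4 := (hgc hp).inner hwC.continuous
  have c5 : Continuous f5 := (hgc hp').inner hwC.continuous
  have cw : Continuous fun x => ‖w x‖ ^ 2 := hwC.continuous.norm.pow 2
  have i1 : IntegrableOn f1 K volume := c1.continuousOn.integrableOn_compact hKc
  have i2 : IntegrableOn f2 K volume := c2.continuousOn.integrableOn_compact hKc
  have i3 : IntegrableOn f3 K volume := c3.continuousOn.integrableOn_compact hKc
  have i4 : IntegrableOn f4 K volume := c4.continuousOn.integrableOn_compact hKc
  have i5 : IntegrableOn f5 K volume := c5.continuousOn.integrableOn_compact hKc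
  have iw : IntegrableOn (fun x => ‖w x‖ ^ 2) K volume := cw.continuousOn.integrableOn_compact hKc
  -- the pointwise identity in the open box
  have hpt : ∀ x ∈ U,
      ⟪FluidPDE.timeDerivWithin (Ici 0) (fun s y => u s y - u' s y) τ x, u τ x - u' τ x⟫ =
        (-f1 x + ν * f2 x) + (-f3 x - f4 x + f5 x) := by
    intro x hx
    rw [hu.timeDerivWithin_fun_sub hu' hS hτ' x, eq_sub_of_add_eq (hmom x hx),
      eq_sub_of_add_eq (hmom' x hx)]
    have hΔ : (Δ w) x = (Δ (u τ)) x - (Δ (u' τ)) x := by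
      exact ((contDiff_infty.1 huC 2).contDiffAt (x := x)).laplacian_sub
        ((contDiff_infty.1 hu'C 2).contDiffAt (x := x))
    have hDw : fderiv ℝ w x = fderiv ℝ (u τ) x - fderiv ℝ (u' τ) x := by
      rw [hw_def]; exact fderiv_fun_sub (hud x) (hu'd x)
    have hsplit : fderiv ℝ (u τ) x (u τ x) =
        fderiv ℝ (u τ) x (w x) + fderiv ℝ (u τ) x (u' τ x) := by
      rw [← map_add]
      congr 1
      simp [hw_def]
    have hvec : (-gradient (p τ) x + ν • (Δ (u τ)) x - convect (u τ) (u τ) x) -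
        (-gradient (p' τ) x + ν • (Δ (u' τ)) x - convect (u' τ) (u' τ) x) =
        -(convect w (u τ) x) + ν • (Δ w) x +
          (-(convect (u' τ) w x) - gradient (p τ) x + gradient (p' τ) x) := by
      have hDw' : fderiv ℝ w x (u' τ x) = fderiv ℝ (u τ) x (u' τ x) - fderiv ℝ (u' τ) x (u' τ x) := by
        rw [hDw]; rfl
      simp only [convect_apply]
      rw [hΔ, hDw', hsplit, smul_sub]
      abel
    have hwx : u τ x - u' τ x = w x := rfl
    rw [hvec, hwx]
    simp only [hf1, hf2, hf3, hf4, hf5, inner_add_left, inner_sub_left, inner_neg_left,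
      real_inner_smul_left]
  -- pass to the open box and back
  have hcongr : ∫ x in K,
      ⟪FluidPDE.timeDerivWithin (Ici 0) (fun s y => u s y - u' s y) τ x, u τ x - u' τ x⟫ =
      ∫ x in K, ((-f1 x + ν * f2 x) + (-f3 x - f4 x + f5 x)) := by
    rw [← setIntegral_congr_set hUK, ← setIntegral_congr_set hUK]
    exact setIntegral_congr_fun hUo.measurableSet hpt
  have i1n : IntegrableOn (fun x => -f1 x) K volume := i1.neg
  have i2ν : IntegrableOn (fun x => ν * f2 x) K volume := i2.const_mul ν
  have i3n : IntegrableOn (fun x => -f3 x) K volume := i3.neg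
  have i34 : IntegrableOn (fun x => -f3 x - f4 x) K volume := i3n.sub i4
  have iA : IntegrableOn (fun x => -f1 x + ν * f2 x) K volume := i1n.add i2ν
  have iB : IntegrableOn (fun x => -f3 x - f4 x + f5 x) K volume := i34.add i5
  have hsplit : ∫ x in K, ((-f1 x + ν * f2 x) + (-f3 x - f4 x + f5 x)) =
      (-(∫ x in K, f1 x) + ν * ∫ x in K, f2 x) +
        (-(∫ x in K, f3 x) - (∫ x in K, f4 x) + ∫ x in K, f5 x) := by
    rw [integral_add iA iB, integral_add i1n i2ν, integral_add i34 i5, integral_sub i3n i4,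
      integral_neg, integral_neg, integral_const_mul]
  rw [hcongr, hsplit]
  -- the three vanishing terms
  have z3 : ∫ x in K, f3 x = 0 :=
    EuclideanSpace.setIntegral_inner_convect_self_eq_zero_of_box a b hab hu'C1 hwC1 hdiv' hw0
  have z4 : ∫ x in K, f4 x = 0 :=
    EuclideanSpace.setIntegral_inner_gradient_eq_zero_of_box a b hab hp hwC1 hdivw hw0
  have z5 : ∫ x in K, f5 x = 0 :=
    EuclideanSpace.setIntegral_inner_gradient_eq_zero_of_box a b hab hp' hwC1 hdivw hw0
  -- the viscous term is nonpositive
  have hvisc : ∫ x in K, f2 x = -∫ x in K, frobeniusNormSq (fderiv ℝ w x) :=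
    EuclideanSpace.setIntegral_inner_laplacian_self_of_box a b hab hwC2 hw0
  have hfrob : 0 ≤ ∫ x in K, frobeniusNormSq (fderiv ℝ w x) :=
    setIntegral_nonneg hKm fun x _ => frobeniusNormSq_nonneg _
  -- the stretching term
  have hstretch : -∫ x in K, f1 x ≤ M * ∫ x in K, ‖w x‖ ^ 2 := by
    rw [← integral_neg, ← integral_const_mul]
    refine setIntegral_mono_on i1.neg (iw.const_mul M) hKm fun x hx => ?_
    have h1 : |f1 x| ≤ ‖fderiv ℝ (u τ) x (w x)‖ * ‖w x‖ := abs_real_inner_le_norm _ _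
    have h2 : ‖fderiv ℝ (u τ) x (w x)‖ ≤ ‖fderiv ℝ (u τ) x‖ * ‖w x‖ :=
      ContinuousLinearMap.le_opNorm _ _
    have h3 : ‖fderiv ℝ (u τ) x‖ * ‖w x‖ * ‖w x‖ ≤ M * ‖w x‖ * ‖w x‖ := by
      gcongr
      exact hM x hx
    have h4 : -f1 x ≤ |f1 x| := neg_le_abs _
    nlinarith [norm_nonneg (w x), h1, h2, h3, h4]
  have hν2 : ν * ∫ x in K, f2 x ≤ 0 := by
    rw [hvisc]
    exact mul_nonpos_of_nonneg_of_nonpos hν (by linarith)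
  linarith [z3, z4, z5, hstretch, hν2]

/-- **Energy uniqueness for classical no-slip Navier–Stokes solutions on a box** (Robinson–Rodrigo–Sadowski
2016 §6.3, Exercise 6.5; Temam 1977 Ch. III): two velocity fields jointly `C^∞` on `[0, ∞) × E`, solving
the unforced Navier–Stokes equations with viscosity `ν ≥ 0` pointwise in the open box for every
`t ≥ 0` (one-sided time derivative within `[0, ∞)`, `C¹` pressure slices), divergence free there,
vanishing on the boundary of the box, and equal on the open box at `t = 0`, coincide on the open
box for all `t ≥ 0`. Proof: energy inequality for `w = u − u'`
(`setIntegral_inner_timeDerivWithin_sub_le_of_box`), integrated in time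
(`integral_Ioo_setIntegral_inner_timeDerivWithin_Ici`), Grönwall (`le_mul_exp_of_le_add_mul_integral`)
with `w(0) = 0`, and continuity. [cite: RobinsonRodrigoSadowskiCUP2016, §6.3 Exercise 6.5 with Thm 6.10 (uniqueness of strong solutions)] -/
theorem EuclideanSpace.eqOn_openBox_of_noSlip_classical (a b : Fin (n+1) → ℝ) (hab : ∀ i, a i < b i)
    {ν : ℝ} (hν : 0 ≤ ν)
    {u u' : ℝ → EuclideanSpace ℝ (Fin (n+1)) → EuclideanSpace ℝ (Fin (n+1))}
    {p p' : ℝ → EuclideanSpace ℝ (Fin (n+1)) → ℝ}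
    (hu : IsSmoothSpaceTimeOn (Ici 0) u) (hu' : IsSmoothSpaceTimeOn (Ici 0) u')
    (hp : ∀ t : ℝ, 0 ≤ t → ContDiff ℝ 1 (p t)) (hp' : ∀ t : ℝ, 0 ≤ t → ContDiff ℝ 1 (p' t))
    (hmom : ∀ t : ℝ, 0 ≤ t → ∀ x ∈ {x : EuclideanSpace ℝ (Fin (n+1)) | ∀ j, a j < x j ∧ x j < b j},
      FluidPDE.timeDerivWithin (Ici 0) u t x + convect (u t) (u t) x =
        -gradient (p t) x + ν • (Δ (u t)) x)
    (hmom' : ∀ t : ℝ, 0 ≤ t → ∀ x ∈ {x : EuclideanSpace ℝ (Fin (n+1)) | ∀ j, a j < x j ∧ x j < b j},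
      FluidPDE.timeDerivWithin (Ici 0) u' t x + convect (u' t) (u' t) x =
        -gradient (p' t) x + ν • (Δ (u' t)) x)
    (hdiv : ∀ t : ℝ, 0 ≤ t → ∀ x ∈ {x : EuclideanSpace ℝ (Fin (n+1)) | ∀ j, a j < x j ∧ x j < b j},
      VectorCalculus.divergence (u t) x = 0)
    (hdiv' : ∀ t : ℝ, 0 ≤ t → ∀ x ∈ {x : EuclideanSpace ℝ (Fin (n+1)) | ∀ j, a j < x j ∧ x j < b j},
      VectorCalculus.divergence (u' t) x = 0)
    (hbc : ∀ t : ℝ, 0 ≤ t →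
      ∀ x ∈ frontier {x : EuclideanSpace ℝ (Fin (n+1)) | ∀ j, a j < x j ∧ x j < b j}, u t x = 0)
    (hbc' : ∀ t : ℝ, 0 ≤ t →
      ∀ x ∈ frontier {x : EuclideanSpace ℝ (Fin (n+1)) | ∀ j, a j < x j ∧ x j < b j}, u' t x = 0)
    (h0 : ∀ x ∈ {x : EuclideanSpace ℝ (Fin (n+1)) | ∀ j, a j < x j ∧ x j < b j}, u 0 x = u' 0 x) :
    ∀ t : ℝ, 0 ≤ t → ∀ x ∈ {x : EuclideanSpace ℝ (Fin (n+1)) | ∀ j, a j < x j ∧ x j < b j},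
      u t x = u' t x := by
  intro T hT
  set K := {x : EuclideanSpace ℝ (Fin (n+1)) | ∀ j, a j ≤ x j ∧ x j ≤ b j} with hK_def
  set U := {x : EuclideanSpace ℝ (Fin (n+1)) | ∀ j, a j < x j ∧ x j < b j} with hU_def
  have hKc : IsCompact K := EuclideanSpace.isCompact_closedBox a b
  have hKm : MeasurableSet K := EuclideanSpace.measurableSet_closedBox a b
  have hUo : IsOpen U := EuclideanSpace.isOpen_openBox a b
  have hUK : U ⊆ K := fun x hx j => ⟨(hx j).1.le, (hx j).2.le⟩
  have hS : UniqueDiffOn ℝ (Ici (0 : ℝ)) := uniqueDiffOn_Ici 0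
  set wst : ℝ → EuclideanSpace ℝ (Fin (n+1)) → EuclideanSpace ℝ (Fin (n+1)) :=
    fun s y => u s y - u' s y with hwst_def
  have hw : IsSmoothSpaceTimeOn (Ici 0) wst := hu.sub hu'
  -- the energy and its continuity
  set Z : ℝ → ℝ := fun s => ∫ x in K, ‖wst s x‖ ^ 2 with hZ_def
  have hZc : ContinuousOn Z (Icc 0 T) :=
    EuclideanSpace.continuousOn_setIntegral_of_continuousOn_Icc hKc
      (G := fun z => ‖wst z.1 z.2‖ ^ 2)
      ((hw.continuousOn.mono (prod_mono Icc_subset_Ici_self Subset.rfl)).norm.pow 2)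
  have hZ0 : Z 0 = 0 := by
    show ∫ x in K, ‖wst 0 x‖ ^ 2 = 0
    rw [← setIntegral_congr_set (EuclideanSpace.openBox_ae_eq_closedBox a b)]
    refine setIntegral_eq_zero_of_forall_eq_zero fun x hx => ?_
    simp [hwst_def, h0 x hx]
  have hZnn : ∀ s, 0 ≤ Z s := fun s => setIntegral_nonneg hKm fun x _ => by positivity
  -- the uniform gradient bound for `u` on `[0, T] × K`
  obtain ⟨M, hM0, hM⟩ := hu.exists_norm_fderiv_le_of_isCompact hKc T
  -- the time-integrated energy inequality
  have hg_cont : ContinuousOn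
      (fun s => ∫ x in K, ⟪FluidPDE.timeDerivWithin (Ici 0) wst s x, wst s x⟫) (Icc 0 T) :=
    EuclideanSpace.continuousOn_setIntegral_of_continuousOn_Icc hKc
      (G := fun z => ⟪FluidPDE.timeDerivWithin (Ici 0) wst z.1 z.2, wst z.1 z.2⟫)
      (((hw.timeDerivWithin hS).continuousOn.inner hw.continuousOn).mono
        (prod_mono Icc_subset_Ici_self Subset.rfl))
  have hineq : ∀ t ∈ Icc 0 T, Z t ≤ 0 + (2 * M) * ∫ s in (0 : ℝ)..t, Z s := by
    intro t ht
    have hF := hw.integral_Ioo_setIntegral_inner_timeDerivWithin_Ici hKc ht.1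
    have hg : ∀ s ∈ Ioo 0 t,
        ∫ x in K, ⟪FluidPDE.timeDerivWithin (Ici 0) wst s x, wst s x⟫ ≤ M * Z s := by
      intro s hs
      have hs0 : 0 ≤ s := hs.1.le
      exact EuclideanSpace.setIntegral_inner_timeDerivWithin_sub_le_of_box a b hab hν hu hu' hs0
        (hp s hs0) (hp' s hs0) (hmom s hs0) (hmom' s hs0) (hdiv s hs0) (hdiv' s hs0) (hbc s hs0)
        (hbc' s hs0) (hM s ⟨hs0, hs.2.le.trans ht.2⟩)
    have hgi : IntegrableOn
        (fun s => ∫ x in K, ⟪FluidPDE.timeDerivWithin (Ici 0) wst s x, wst s x⟫) (Ioo 0 t) volume :=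
      ((hg_cont.mono (Icc_subset_Icc_right ht.2)).integrableOn_compact isCompact_Icc).mono_set
        Ioo_subset_Icc_self
    have hZi : IntegrableOn (fun s => M * Z s) (Ioo 0 t) volume :=
      (((hZc.mono (Icc_subset_Icc_right ht.2)).integrableOn_compact isCompact_Icc).mono_set
        Ioo_subset_Icc_self).const_mul M
    have hmono := setIntegral_mono_on hgi hZi measurableSet_Ioo hg
    have hMZ : ∫ s in Ioo 0 t, M * Z s = M * ∫ s in (0 : ℝ)..t, Z s := by
      rw [intervalIntegral.integral_of_le ht.1, integral_Ioc_eq_integral_Ioo, integral_const_mul]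
    have hZ0' : ∫ x in K, ‖wst 0 x‖ ^ 2 = 0 := hZ0
    rw [hF, hZ0', hMZ] at hmono
    have : Z t = ∫ x in K, ‖wst t x‖ ^ 2 := rfl
    linarith
  have hgr := le_mul_exp_of_le_add_mul_integral hZc (by positivity) hineq T ⟨hT, le_rfl⟩
  have hZT : Z T = 0 := le_antisymm (by simpa using hgr) (hZnn T)
  -- conclusion by continuity
  have hTI : T ∈ Ici (0 : ℝ) := hT
  have cwT : Continuous fun x => ‖wst T x‖ ^ 2 := (hw.contDiff_slice hTI).continuous.norm.pow 2
  have hint : IntegrableOn (fun x => ‖wst T x‖ ^ 2) K volume :=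
    cwT.continuousOn.integrableOn_compact hKc
  have hae : (fun x => ‖wst T x‖ ^ 2) =ᵐ[volume.restrict K] 0 :=
    (setIntegral_eq_zero_iff_of_nonneg_ae (Eventually.of_forall fun x => by positivity) hint).1 hZT
  have haeU : (fun x => ‖wst T x‖ ^ 2) =ᵐ[volume.restrict U] 0 :=
    ae_restrict_of_ae_restrict_of_subset hUK hae
  have hEq : EqOn (fun x => ‖wst T x‖ ^ 2) 0 U :=
    Measure.eqOn_open_of_ae_eq haeU hUo cwT.continuousOn continuousOn_const
  intro x hx
  have h := hEq hx
  simp only [Pi.zero_apply, hwst_def] at h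
  have h' : ‖u T x - u' T x‖ = 0 := pow_eq_zero_iff (n := 2) (by norm_num) |>.1 h
  exact sub_eq_zero.1 (norm_eq_zero.1 h')

end Literature.Analysis.FluidPDE
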